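import Summits.BirchSwinnertonDyer.BirchSwinnertonDyer.Theorems.ClassRecordThreeRegCertKernelUniformLog
import Summits.BirchSwinnertonDyer.BirchSwinnertonDyer.Theorems.ClassRecordThreeRegCertKernelUniformUnit
import HarnessLib

/-!
# Route `ClassRecordThree`, crux `SchneiderAtThree` (item 19106): the PRECISION-PARAMETRISED deep REG3CERT kernel
# checker — `heightFourOneCoord W 3 q x y ≠ 0` at a certificate point of depth `K ≥ 2` to ANY `3`-adic precision `N`
# (cell `bsd-stepL`, seat `bsd-stepL-reg3-eng` g4; `--supports stmt-BirchSwinnertonDyer-19106`)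

HONEST FRAMING: BSD is not proved by any of this; nothing here closes the crux; Schneider's non-degeneracy conjecture
(barrier `PAdicHeightNondegeneracy`) is asserted NOWHERE; every application is ONE curve. Companion of the fixed-modulus
checkers `…RegCertKernel{Deep,O2Deep,O3Deep,O3Mid,O4Deep,O4Mid}` (seat g3): those decide `h mod 3^{v+1}` for `v ≤ 4` by
residue chains whose moduli are hard-wired for the worst case `v₃(Δ) = 1`. Here every modulus is a PARAMETER
(`K, N, m, δ` with explicit inequalities): quartic `log_Ŵ` (`…UniformSeries` §1), `ch` to third order (§2), `C²` to `3⁻ᵐ`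
by FIRST-order Tate expansions and the curve's own `3^δ ∣ Δ` (§3), `Π` to first order in `q` (`…O3Sigma`), the unit
part `C²σ²/3^{2K} ≡ υ (mod 3ᴺ)` (`…UniformUnit`), and the two Iwasawa logarithms NOT expanded (`…UniformLog` §4): the
certificate is the single integer fact **`3^N ∤ υ² − e'⁴`**.

* **`heightFourOneCoord_ne_zero_of_uniformCert`** — the height inequality for THE Tate parameter;
* **`certNonsplit_of_uniformCert`** — `RegMult.CertNonsplit W 3 Q 1` from ONE bundled integer hypothesis (per row: `norm_num`).

Validated offline before the Lean (seat folder `work/val/validate_uniform.py`): the residues `(Γ, λ, υ)` reproduce engine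
A's unit part of `C²σ²` on all 15 remaining non-huge REG3CERT rows (the 11 rows with `v₃(e(Q)) = 1` re-pointed to
`Q' = 3Q`, depth `K = 2`; `v₃(h(Q')) = v₃(h(Q)) + 2`). Theorems only (0 defs, 0 facts).
References: [SteinWuthrich2013] §4.2; [SilvermanAEC2009] VII.3.4; [SilvermanATAEC1994] Lemma V.5.1; [Iwasawa1972PadicL] §4.4;
[KolyvaginEulerSystems1990] Thm. A (GZK).
-/

open scoped Classical

open PowerSeries WeierstrassCurve Literature.NumberTheory.EllipticCurves
  Literature.NumberTheory.EllipticCurves.Rank1Residual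
  Literature.NumberTheory.EllipticCurves.SteinWuthrich2013
  Summit.BirchSwinnertonDyer.Rank1Residual
  Summit.BirchSwinnertonDyer.Rank1Residual.X11b
  Summit.BirchSwinnertonDyer.Rank1Residual.X11b.RegMult.Rung62310y1

namespace Summit.BirchSwinnertonDyer.Rank1Residual.X11b.RegMult.KernelCert

/-! ### §0 Plumbing -/

/-- `‖3^k‖₃ = 1/3^k`. [folklore] -/
private theorem norm_three_pow (k : ℕ) : ‖(3 : ℚ_[3]) ^ k‖ = 1 / (3 : ℝ) ^ k := by
  rw [norm_pow, show (3 : ℚ_[3]) = ((3 : ℕ) : ℚ_[3]) by norm_cast, Padic.norm_p]; simp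

/-- `1/3^l ≤ 1/3^k` for `k ≤ l`. [folklore] -/
private theorem third_pow_le {k l : ℕ} (h : k ≤ l) : 1 / (3 : ℝ) ^ l ≤ 1 / (3 : ℝ) ^ k :=
  one_div_le_one_div_of_le (by positivity) (pow_le_pow_right₀ (by norm_num) h)

/-! ### §1 The uniform deep certificate and the `CertNonsplit` wrapper -/

/-- **The precision-parametrised deep REG3CERT kernel certificate.** Let `W/ℚ` be globally minimal with integer model
`⟨a₁,…,a₆⟩`, `c₄, c₆` `3`-adic units, `3^δ ∣ Δ` (`δ ≥ 1`), `1/j(W) = Δ/c₄³`; let `(x, y) = (a/e², b/e³)` with `e = 3ᴷe'`,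
`K ≥ 2`, `3 ∤ e'`, `3 ∤ b`, `gcd(a, e) = 1`; let `Γ, λ, υ` be integers prime to `3` with
`3^m ∣ (c₄³ − 504Δ)c₄ + Γc₆(c₄³ + 240Δ)` (`C² ≡ Γ`), the `λ`-congruence of `norm_formalLog_unitPart_sub_le`
(`log_Ŵ(z)/3ᴷ ≡ λ`), the `υ`-congruence of `norm_unitPart_sub_le` (`C²σ²/3^{2K} ≡ υ`), under the exponent inequalities
`m ≤ 2δ+1`, `m ≤ N`, `N ≤ 4K`, `N + 2 ≤ 6K`, `N + 1 ≤ m + 2K`, `N ≤ 2δ + 2K`, `N + 1 ≤ δ + 4K`. If **`3^N ∤ υ² − e'⁴`** then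
`heightFourOneCoord W 3 q x y ≠ 0` for THE Tate parameter `q` (`‖q‖ < 1`, `j(q) = j(W)`): `h = log₃(e²) − log₃(C²σ²)` with
`e² = 3^{2K}e'²`, `C²σ² ≡ 3^{2K}υ`, and §4. [cite: SteinWuthrich2013, §4.2] [cite: Iwasawa1972PadicL, §4.4]
[cite: SilvermanATAEC1994, Lemma V.5.1] -/
theorem heightFourOneCoord_ne_zero_of_uniformCert (W : WeierstrassCurve ℚ) [W.IsElliptic] [W.IsGloballyMinimal]
    {a₁ a₂ a₃ c4 c6 D : ℤ} (ha1 : (W.baseChange ℚ_[3]).a₁ = a₁) (ha2 : (W.baseChange ℚ_[3]).a₂ = a₂)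
    (ha3 : (W.baseChange ℚ_[3]).a₃ = a₃) (hc4 : (W.baseChange ℚ_[3]).c₄ = c4) (hc6 : (W.baseChange ℚ_[3]).c₆ = c6)
    (h3c4 : ¬ (3 : ℤ) ∣ c4) (h3c6 : ¬ (3 : ℤ) ∣ c6) (hjinv : ((W.j : ℚ_[3]))⁻¹ = (D : ℚ_[3]) / (c4 : ℚ_[3]) ^ 3)
    {δ : ℕ} (hδ : (3 : ℤ) ^ δ ∣ D) (hδ1 : 1 ≤ δ)
    {a b : ℤ} {e' K : ℕ} (hK : 2 ≤ K) (h3e' : ¬ (3 : ℤ) ∣ e') (h3b : ¬ (3 : ℤ) ∣ b)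
    (hcop : Nat.Coprime a.natAbs (3 ^ K * e'))
    {x y : ℚ} (hx : x = a / ((3 ^ K * e' : ℕ) : ℚ) ^ 2) (hy : y = b / ((3 ^ K * e' : ℕ) : ℚ) ^ 3)
    {Γ lam ups : ℤ} {N m : ℕ} (h3Γ : ¬ (3 : ℤ) ∣ Γ) (h3lam : ¬ (3 : ℤ) ∣ lam) (h3ups : ¬ (3 : ℤ) ∣ ups)
    (hmδ : m ≤ 2 * δ + 1) (hm1 : 1 ≤ m) (hmN : m ≤ N) (hN1 : 1 ≤ N) (hNK : N ≤ 4 * K) (hN6K : N + 2 ≤ 6 * K)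
    (hm : N + 1 ≤ m + 2 * K) (hPa : N ≤ 2 * δ + 2 * K) (hPb : N + 1 ≤ δ + 4 * K)
    (hΓ : (3 : ℤ) ^ m ∣ (c4 ^ 3 - 504 * D) * c4 + Γ * c6 * (c4 ^ 3 + 240 * D))
    (hlam : (3 : ℤ) ^ (N + 1) ∣ -12 * (a * e') * b ^ 3 + 6 * a₁ * 3 ^ K * (a * e') ^ 2 * b ^ 2 -
      4 * (a₁ ^ 2 + a₂) * 3 ^ (2 * K) * (a * e') ^ 3 * b + 3 * (a₁ ^ 3 + 2 * a₁ * a₂ + 2 * a₃) * 3 ^ (3 * K) * (a * e') ^ 4 -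
      12 * lam * b ^ 4)
    (hups : (3 : ℤ) ^ (N + 2) ∣ lam ^ 2 * (360 * Γ ^ 2 + 30 * 3 ^ (2 * K) * lam ^ 2 * Γ + 3 ^ (4 * K) * lam ^ 4) *
      (c4 ^ 3 * Γ - 2 * 3 ^ (2 * K) * D * lam ^ 2) - 360 * Γ ^ 3 * c4 ^ 3 * ups)
    (hcert : ¬ (3 : ℤ) ^ N ∣ ups ^ 2 - (e' : ℤ) ^ 4)
    {q : ℚ_[3]} (hq : ‖q‖ < 1) (hj : tateJ q = (W.j : ℚ_[3])) : heightFourOneCoord W 3 q x y ≠ 0 := by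
  have he'0 : e' ≠ 0 := by rintro rfl; exact h3e' (by simp)
  have he0 : (3 ^ K * e' : ℕ) ≠ 0 := by positivity
  have hb0 : b ≠ 0 := by rintro rfl; exact h3b (dvd_zero 3)
  have h3a : ¬ (3 : ℤ) ∣ a := by
    intro h
    have h1 : 3 ∣ a.natAbs := Int.natCast_dvd.mp h
    have h3 : 3 ∣ Nat.gcd a.natAbs (3 ^ K * e') := Nat.dvd_gcd h1 (dvd_mul_of_dvd_left (dvd_pow_self 3 (by omega)) e')
    rw [hcop] at h3; omega
  have hc4n : ‖(c4 : ℚ_[3])‖ = 1 := norm_intCast_eq_one_of_not_dvd h3c4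
  have he'n : ‖(e' : ℚ_[3])‖ = 1 := by
    have := norm_intCast_eq_one_of_not_dvd h3e'; push_cast at this; exact this
  -- THE Tate parameter: `‖q‖ ≤ 3^{−δ}`, `‖q − Δ/c₄³‖ ≤ 3^{−2δ}`
  set t : ℚ_[3] := (D : ℚ_[3]) / (c4 : ℚ_[3]) ^ 3 with ht
  have htn : ‖t‖ ≤ 1 / (3 : ℝ) ^ δ := by
    rw [ht, norm_div, norm_pow, hc4n, one_pow, div_one]; exact norm_intCast_le_of_pow_dvd hδ
  have hqn : ‖q‖ ≤ 1 / (3 : ℝ) ^ δ := by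
    have h1 : ‖tateJ q‖ = ‖q‖⁻¹ := norm_tateJ_eq hq
    rw [hj] at h1
    have h2 : ‖q‖ = ‖((W.j : ℚ_[3]))⁻¹‖ := by rw [norm_inv, h1, inv_inv]
    rw [h2, hjinv]; exact htn
  have hqD : ‖q - t‖ ≤ 1 / (3 : ℝ) ^ (2 * δ) := by
    have h := norm_inv_tateJ_sub_le hq
    rw [hj, hjinv, ← norm_neg, neg_sub] at h
    refine h.trans ?_
    calc ‖q‖ * ‖q‖ ≤ 1 / (3 : ℝ) ^ δ * (1 / (3 : ℝ) ^ δ) := by gcongr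
      _ = 1 / (3 : ℝ) ^ (2 * δ) := by rw [two_mul, pow_add]; field_simp
  -- `C² ≡ Γ (mod 3^m)`
  have hC := norm_uniformisationScaleSq_sub_le_of_disc W hc4 hc6 h3c4 h3c6 hδ1 hmδ hΓ hqn hqD
  set C2 := uniformisationScaleSq W 3 q with hC2
  -- the formal logarithm and its unit part
  set V := W.baseChange ℚ_[3] with hV
  set z : ℚ_[3] := -((a : ℚ_[3]) * ((3 ^ K * e' : ℕ) : ℚ_[3])) / (b : ℚ_[3]) with hz
  obtain ⟨hΛ, hLn⟩ := norm_formalLog_unitPart_sub_le V ha1 ha2 ha3 hK hNK h3a h3b h3e' hlam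
  set L := V.padicFormalLog z with hLdef
  set P' : ℚ_[3] := (3 : ℚ_[3]) ^ K with hP'
  have hP'0 : P' ≠ 0 := pow_ne_zero K (by norm_num)
  set Λ : ℚ_[3] := L * P'⁻¹ with hΛdef
  have hLΛ : L = P' * Λ := by rw [hΛdef]; field_simp
  -- `w = L²/C² = 3^{2K}·Λ²/C²`
  have hΓn : ‖(Γ : ℚ_[3])‖ = 1 := norm_intCast_eq_one_of_not_dvd h3Γ
  have hCn : ‖C2‖ = 1 := by
    rw [← hΓn]
    refine Padic.norm_eq_of_norm_sub_lt_right (hC.trans_lt ?_)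
    rw [hΓn]
    calc 1 / (3 : ℝ) ^ m ≤ 1 / (3 : ℝ) ^ 1 := third_pow_le (by omega)
      _ < 1 := by norm_num
  have hC0 : C2 ≠ 0 := by intro h; rw [h, norm_zero] at hCn; exact zero_ne_one hCn
  have hwdef : logUnitParamSq W 3 q x y = L ^ 2 / C2 := by
    rw [logUnitParamSq, hx, hy, neg_div_cast_eq hb0 he0]
  have hw : L ^ 2 / C2 = (3 : ℚ_[3]) ^ (2 * K) * (Λ ^ 2 / C2) := by
    rw [hLΛ, hP', mul_pow, ← pow_mul, mul_comm K 2]; ring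
  set w := L ^ 2 / C2 with hwdef'
  have hΛn : ‖Λ‖ = 1 := by
    rw [hΛdef, norm_mul, norm_inv, hLn, hP', norm_three_pow]; field_simp
  have hwn : ‖w‖ = 1 / (3 : ℝ) ^ (2 * K) := by
    rw [hw, norm_mul, norm_three_pow, norm_div, norm_pow, hΛn, hCn]; norm_num
  have hw81 : ‖w‖ ≤ 1 / 81 := by
    rw [hwn]; calc 1 / (3 : ℝ) ^ (2 * K) ≤ 1 / (3 : ℝ) ^ (2 * 2) := third_pow_le (by omega)
      _ = 1 / 81 := by norm_num
  set c := coshOfSq w with hc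
  have hc1 : ‖(c - 1) - w / 2‖ ≤ 3 * ‖w‖ ^ 2 := by
    have := norm_coshOfSq_sub_one_sub_half_le hw81; rwa [hc]
  have hc3 : ‖c - 1 - w / 2 - w ^ 2 / 24 - w ^ 3 / 720‖ ≤ 9 * ‖w‖ ^ 4 := by
    have := norm_coshOfSq_sub_cubic_le_deep hw81; rwa [hc]
  have h2n : ‖(2 : ℚ_[3])‖ = 1 := by
    rw [show (2 : ℚ_[3]) = ((2 : ℤ) : ℚ_[3]) by norm_cast]; exact norm_intCast_eq_one_of_not_dvd (by decide)
  have hcn : ‖c‖ ≤ 1 := by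
    have hw2 : ‖w / 2‖ = ‖w‖ := by rw [norm_div, h2n, div_one]
    have hwpos : 0 < ‖w‖ := by rw [hwn]; positivity
    have hc1n : ‖c - 1‖ = ‖w‖ := by
      rw [← hw2]
      refine Padic.norm_eq_of_norm_sub_lt_right (hc1.trans_lt ?_)
      rw [hw2]
      calc 3 * ‖w‖ ^ 2 = (3 * ‖w‖) * ‖w‖ := by ring
        _ < 1 * ‖w‖ := by gcongr; linarith
        _ = ‖w‖ := one_mul _
    have : c = (c - 1) + 1 := by ring
    rw [this]
    refine (IsUltrametricDist.norm_add_le_max _ _).trans (max_le ?_ (by rw [norm_one]))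
    rw [hc1n]; linarith
  have hPr := norm_tprod_tateSigmaSq_factor_sub_linear_le hq hcn
  set Pr := ∏' n : ℕ, (1 - 2 * q ^ (n + 1) * c + q ^ (2 * (n + 1))) ^ 2 / (1 - q ^ (n + 1)) ^ 4 with hPrdef
  have hσ : tateSigmaSq q c = 2 * (c - 1) * Pr := by rw [tateSigmaSq]
  -- the unit part of `Y = C²σ²`
  have hY := norm_unitPart_sub_le (Λ := Λ) (C2 := C2) (w := w) (c := c) (Pr := Pr) (q := q) (ups := ups)
    (by omega : 1 ≤ K) hm1 hmN hN6K hm hPa hPb h3lam h3Γ h3c4 hδ hΛ hC hw hc1 hc3 hPr hqn hqD hups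
  set P : ℚ_[3] := (3 : ℚ_[3]) ^ (2 * K) with hP
  have hP0 : P ≠ 0 := pow_ne_zero _ (by norm_num)
  -- the denominator `e² = 3^{2K}·e'²`
  have hden : x.den = (3 ^ K * e') ^ 2 := by
    have hpos : (0 : ℤ) < ((3 ^ K * e' : ℕ) : ℤ) ^ 2 := by positivity
    have hcop2 : Nat.Coprime a.natAbs ((((3 ^ K * e' : ℕ) : ℤ) ^ 2).natAbs) := by
      rw [Int.natAbs_pow, Int.natAbs_natCast]; exact hcop.pow_right 2
    have h := Rat.den_div_eq_of_coprime hpos hcop2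
    have hx' : x = ((a : ℤ) : ℚ) / ((((3 ^ K * e' : ℕ) : ℤ) ^ 2 : ℤ) : ℚ) := by rw [hx]; push_cast; ring
    rw [← hx'] at h
    exact_mod_cast h
  have hA : ‖(((x.den : ℚ)) : ℚ_[3]) - P * (((e' : ℤ) ^ 2 : ℤ) : ℚ_[3])‖ ≤ ‖P‖ / (3 : ℝ) ^ N := by
    have : (((x.den : ℚ)) : ℚ_[3]) = P * (((e' : ℤ) ^ 2 : ℤ) : ℚ_[3]) := by
      rw [hden, hP]; push_cast; rw [mul_pow, ← pow_mul, mul_comm K 2]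
    rw [this, sub_self, norm_zero]; positivity
  have hB : ‖C2 * tateSigmaSq q c - P * ups‖ ≤ ‖P‖ / (3 : ℝ) ^ N := by rw [hσ]; exact hY
  have h3α : ¬ (3 : ℤ) ∣ (e' : ℤ) ^ 2 := fun h => h3e' (Int.Prime.dvd_pow' (by norm_num) h)
  have hne := padicLog_ne_padicLog_of_unitResidue hP0 h3α h3ups hN1 hA hB
    (by rw [← pow_mul]; exact hcert)
  intro h0
  rw [heightFourOneCoord, hwdef] at h0
  exact hne (sub_eq_zero.mp h0)

/-- **`RegMult.CertNonsplit W 3 Q 1` from a UNIFORM deep REG3CERT certificate.** For the integer model `W = ⟨a₁,…,a₆⟩`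
(globally minimal, elliptic) and a point `Q = (x, y) = (a/e², b/e³)` of `W` with `e = 3ᴷe'`, the single hypothesis `H`
bundles the row's INTEGER facts: `c₄, c₆, Δ` by the standard formulas, `3 ∤ c₄`, `3 ∤ c₆`, `3^δ ∣ Δ`, `2 ≤ K`, `3 ∤ e'`,
`3 ∤ b`, `gcd(a, e) = 1`, the gcd reduction test, the residues `Γ, λ, υ` (all prime to `3`) with their three congruences
(moduli `3^m`, `3^{N+1}`, `3^{N+2}`), the exponent inequalities, and the certificate **`3^N ∤ υ² − e'⁴`** — decided per row
by ONE `norm_num`. Conclusion: `Q = 1 • Q` is admissible at `3` (`isAdmissible_of_one_lt_norm`, `hasNonsingularReductionAt_of_gcd`)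
and `heightFourOneCoord W 3 q x y ≠ 0` for THE Tate parameter (`heightFourOneCoord_ne_zero_of_uniformCert`). Decides the
REG3CERT rows of any height valuation at depth `K ≥ 2`. Per curve; nothing class-wide.
[cite: SteinWuthrich2013, §4.2] [cite: MazurSteinTate2006, §1] [cite: SilvermanAEC2009, VII.3.4] -/
theorem certNonsplit_of_uniformCert (W : WeierstrassCurve ℚ) {a₁ a₂ a₃ a₄ a₆ : ℤ} (hW : W = ⟨a₁, a₂, a₃, a₄, a₆⟩)
    [W.IsElliptic] [W.IsGloballyMinimal] {a b c4 c6 D Γ lam ups : ℤ} {e' K n δ N m : ℕ}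
    (H : c4 = (a₁ ^ 2 + 4 * a₂) ^ 2 - 24 * (2 * a₄ + a₁ * a₃) ∧
      c6 = -(a₁ ^ 2 + 4 * a₂) ^ 3 + 36 * (a₁ ^ 2 + 4 * a₂) * (2 * a₄ + a₁ * a₃) - 216 * (a₃ ^ 2 + 4 * a₆) ∧
      D = -(a₁ ^ 2 + 4 * a₂) ^ 2 * (a₁ ^ 2 * a₆ + 4 * a₂ * a₆ - a₁ * a₃ * a₄ + a₂ * a₃ ^ 2 - a₄ ^ 2) -
        8 * (2 * a₄ + a₁ * a₃) ^ 3 - 27 * (a₃ ^ 2 + 4 * a₆) ^ 2 +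
        9 * (a₁ ^ 2 + 4 * a₂) * (2 * a₄ + a₁ * a₃) * (a₃ ^ 2 + 4 * a₆) ∧
      ¬ (3 : ℤ) ∣ c4 ∧ ¬ (3 : ℤ) ∣ c6 ∧ (3 : ℤ) ^ δ ∣ D ∧ 1 ≤ δ ∧ 2 ≤ K ∧ ¬ (3 : ℤ) ∣ e' ∧ ¬ (3 : ℤ) ∣ b ∧
      Nat.Coprime a.natAbs (3 ^ K * e') ∧
      Int.gcd (2 * b + a₁ * a * (3 ^ K * e' : ℕ) + a₃ * (3 ^ K * e' : ℕ) ^ 3)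
        (a₁ * b * (3 ^ K * e' : ℕ) - (3 * a ^ 2 + 2 * a₂ * a * (3 ^ K * e' : ℕ) ^ 2 + a₄ * (3 ^ K * e' : ℕ) ^ 4)) ∣
        (3 ^ K * e') ^ n ∧
      ¬ (3 : ℤ) ∣ Γ ∧ ¬ (3 : ℤ) ∣ lam ∧ ¬ (3 : ℤ) ∣ ups ∧
      m ≤ 2 * δ + 1 ∧ 1 ≤ m ∧ m ≤ N ∧ 1 ≤ N ∧ N ≤ 4 * K ∧ N + 2 ≤ 6 * K ∧ N + 1 ≤ m + 2 * K ∧ N ≤ 2 * δ + 2 * K ∧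
      N + 1 ≤ δ + 4 * K ∧
      (3 : ℤ) ^ m ∣ (c4 ^ 3 - 504 * D) * c4 + Γ * c6 * (c4 ^ 3 + 240 * D) ∧
      (3 : ℤ) ^ (N + 1) ∣ -12 * (a * e') * b ^ 3 + 6 * a₁ * 3 ^ K * (a * e') ^ 2 * b ^ 2 -
        4 * (a₁ ^ 2 + a₂) * 3 ^ (2 * K) * (a * e') ^ 3 * b +
        3 * (a₁ ^ 3 + 2 * a₁ * a₂ + 2 * a₃) * 3 ^ (3 * K) * (a * e') ^ 4 - 12 * lam * b ^ 4 ∧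
      (3 : ℤ) ^ (N + 2) ∣ lam ^ 2 * (360 * Γ ^ 2 + 30 * 3 ^ (2 * K) * lam ^ 2 * Γ + 3 ^ (4 * K) * lam ^ 4) *
        (c4 ^ 3 * Γ - 2 * 3 ^ (2 * K) * D * lam ^ 2) - 360 * Γ ^ 3 * c4 ^ 3 * ups ∧
      ¬ (3 : ℤ) ^ N ∣ ups ^ 2 - (e' : ℤ) ^ 4)
    {x y : ℚ} (hx : x = a / ((3 ^ K * e' : ℕ) : ℚ) ^ 2) (hy : y = b / ((3 ^ K * e' : ℕ) : ℚ) ^ 3)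
    (h : W.toAffine.Nonsingular x y) : RegMult.CertNonsplit W 3 (.some x y h) 1 := by
  obtain ⟨hc4, hc6, hD, h3c4, h3c6, hδ, hδ1, hK, h3e', h3b, hcop, hgcd, h3Γ, h3lam, h3ups, hmδ, hm1, hmN, hN1, hNK,
    hN6K, hm, hPa, hPb, hΓ, hlam, hups, hcert⟩ := H
  have he'0 : e' ≠ 0 := by rintro rfl; exact h3e' (by simp)
  have he0 : (3 ^ K * e' : ℕ) ≠ 0 := by positivity
  have h3e : 3 ∣ 3 ^ K * e' := dvd_mul_of_dvd_left (dvd_pow_self 3 (by omega)) e'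
  have hx1 : 1 < ‖(x : ℚ_[3])‖ := by
    haveI : Fact (Nat.Prime 3) := ⟨Nat.prime_three⟩
    exact (one_lt_norm_ratCast_iff 3 x).mpr (padicValRat_x_neg he0 hx hcop h3e)
  have hadm : W.IsAdmissible 3 (.some x y h) :=
    isAdmissible_of_one_lt_norm (by norm_num) h hx1 (hasNonsingularReductionAt_of_gcd W hW he0 hx hy hcop hgcd)
  refine ⟨by rw [one_smul]; exact hadm, fun q _ hq1 hqj => ?_⟩
  rw [one_smul]
  exact heightFourOneCoord_ne_zero_of_uniformCert W (baseChange_a₁_eq W hW) (baseChange_a₂_eq W hW)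
    (baseChange_a₃_eq W hW) (baseChange_c₄_eq W hW hc4) (baseChange_c₆_eq W hW hc6) h3c4 h3c6
    (ratCast_j_inv_eq W hW hc4 hD) hδ hδ1 hK h3e' h3b hcop hx hy h3Γ h3lam h3ups hmδ hm1 hmN hN1 hNK hN6K hm hPa hPb
    hΓ hlam hups hcert hq1 hqj

end Summit.BirchSwinnertonDyer.Rank1Residual.X11b.RegMult.KernelCert
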